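import Mathlib
import HarnessLib

/-!
# `RationalShortRootRigidity` — Step 2 assembly helper (§C of the `stub_planar` plan): weighted independence of `u₂^i u₃^j`

Helper lemma INSIDE the paper proof of crux `stmt-QuantumFields-23124` (`F4SubCurvatureDoor.RationalShortRootRigidity`,
LINE g15-A of planner ym-idea-3; owner's assembly plan HOME l15/STUB-PLAN-Planar.md §C/§E: the degree bookkeeping that turns
`T = c·(x²+y²)^k` (from `mobiusTopForm`) and `deg b ≤ 2k` into the support condition `2i + 3j ≤ 2k − 1` off `(k,0)` needed by
`noU3Lemma`):

**Lemma** (`weighted_independence`).  The homogeneous polynomials `(x²+y²)^i (3x²y − y³)^j` with a FIXED weight `2i + 3j = w` are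
linearly independent: if `Σ_{(i,j) ∈ S} a_ij (x²+y²)^i (3x²y−y³)^j = 0` for all real `(x,y)` and `2i+3j = w` on `S`, then all `a_ij = 0`.

Proof (owner's hint «evaluate at `y = 1`»): on `y = 1` the relation reads `Σ a_ij (x²+1)^i (3x²−1)^j = 0`; the weight fixes `i` in terms
of `j`; factor out the smallest power `(3x²−1)^{j₀}`, pass to the polynomial identity (infinitely many `x` with `3x² ≠ 1`), and evaluate at
`x₀ = √(1/3)`, where only the `j₀`-term survives: `a_{i₀j₀}·(4/3)^{i₀} = 0`.  Induct on `#S`.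

Mathlib only; THEOREMS ONLY (no definitions); no named facts; no `sorry`; default heartbeats.  Nothing about the crux 23124, the route's
rung or the Yang–Mills mass gap is proved here.  Free-hands seat `ym-line-frs-p2` g10, `--supports stmt-QuantumFields-23124`.
-/

set_option autoImplicit false

namespace Summit.QuantumFields.YangMills.Theorems.RationalShortRootRigidity

open Polynomial
open scoped BigOperators Polynomial

/-- **Weighted linear independence of `u₂^i u₃^j`** (STUB-PLAN-Planar §C). [folklore] -/
theorem weighted_independence (w : ℕ) (S : Finset (ℕ × ℕ)) (a : ℕ × ℕ → ℝ)
    (hw : ∀ ij ∈ S, 2 * ij.1 + 3 * ij.2 = w)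
    (h : ∀ x y : ℝ, (∑ ij ∈ S, a ij * (x ^ 2 + y ^ 2) ^ ij.1 * (3 * x ^ 2 * y - y ^ 3) ^ ij.2) = 0) :
    ∀ ij ∈ S, a ij = 0 := by
  classical
  suffices H : ∀ (n : ℕ) (S : Finset (ℕ × ℕ)), S.card ≤ n → (∀ ij ∈ S, 2 * ij.1 + 3 * ij.2 = w) →
      (∀ x : ℝ, (∑ ij ∈ S, a ij * (x ^ 2 + 1) ^ ij.1 * (3 * x ^ 2 - 1) ^ ij.2) = 0) → ∀ ij ∈ S, a ij = 0 by
    refine H _ S le_rfl hw fun x => ?_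
    have := h x 1
    simpa only [one_pow, mul_one] using this
  intro n
  induction n with
  | zero =>
    intro S hS _ _ ij hij
    rw [Nat.le_zero, Finset.card_eq_zero] at hS
    rw [hS] at hij
    exact absurd hij (Finset.notMem_empty _)
  | succ n IH =>
    intro S hS hwS hS0 ij hij
    -- the smallest exponent `j₀` and the (unique) term carrying it
    have hne : S.Nonempty := ⟨ij, hij⟩
    set j₀ : ℕ := (S.image Prod.snd).min' (hne.image _) with hj₀
    obtain ⟨ij₀, hij₀, hij₀2⟩ : ∃ ij₀ ∈ S, ij₀.2 = j₀ := by
      have := Finset.min'_mem (S.image Prod.snd) (hne.image _)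
      rw [← hj₀, Finset.mem_image] at this
      exact this
    have hmin : ∀ ij' ∈ S, j₀ ≤ ij'.2 := fun ij' hij' =>
      Finset.min'_le _ _ (Finset.mem_image_of_mem Prod.snd hij')
    have huniq : ∀ ij' ∈ S, ij'.2 = j₀ → ij' = ij₀ := by
      intro ij' hij' hj
      have h1 := hwS ij' hij'
      have h2 := hwS ij₀ hij₀
      ext
      · omega
      · rw [hj, hij₀2]
    -- the reduced polynomial `Q₁ = Σ a_ij (X²+1)^i (3X²−1)^{j−j₀}` vanishes off `3x² = 1`, hence identically
    set Q₁ : ℝ[X] := ∑ ij' ∈ S, C (a ij') * (X ^ 2 + 1) ^ ij'.1 * (3 * X ^ 2 - 1) ^ (ij'.2 - j₀) with hQ₁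
    have hQ₁_eval : ∀ x : ℝ, Q₁.eval x = ∑ ij' ∈ S, a ij' * (x ^ 2 + 1) ^ ij'.1 * (3 * x ^ 2 - 1) ^ (ij'.2 - j₀) := by
      intro x
      rw [hQ₁, eval_finsetSum]
      refine Finset.sum_congr rfl fun ij' _ => ?_
      simp only [eval_mul, eval_C, eval_pow, eval_add, eval_sub, eval_X, eval_one, eval_ofNat]
    have hfactor : ∀ x : ℝ, (3 * x ^ 2 - 1) ^ j₀ * Q₁.eval x = 0 := by
      intro x
      rw [hQ₁_eval, Finset.mul_sum, ← hS0 x]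
      refine Finset.sum_congr rfl fun ij' hij' => ?_
      have hle := hmin ij' hij'
      obtain ⟨m, hm⟩ := Nat.exists_eq_add_of_le hle
      rw [hm, Nat.add_sub_cancel_left, pow_add]
      ring
    have hQ₁0 : Q₁ = 0 := by
      apply Polynomial.eq_zero_of_infinite_isRoot
      refine (Set.Ioi_infinite (1 : ℝ)).mono fun x hx => ?_
      have hx1 : (1 : ℝ) < x := hx
      have hne3 : (3 * x ^ 2 - 1) ^ j₀ ≠ 0 := pow_ne_zero _ (by nlinarith)
      exact (mul_eq_zero.1 (hfactor x)).resolve_left hne3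
    -- evaluate at `x₀ = √(1/3)`
    have hcoef : a ij₀ = 0 := by
      set x₀ : ℝ := Real.sqrt (1 / 3) with hx₀
      have hx₀2 : x₀ ^ 2 = 1 / 3 := Real.sq_sqrt (by norm_num)
      have h1 := hQ₁_eval x₀
      rw [hQ₁0, eval_zero, Finset.sum_eq_single ij₀] at h1
      · rw [hij₀2, Nat.sub_self, pow_zero, mul_one, hx₀2] at h1
        have : ((1 : ℝ) / 3 + 1) ^ ij₀.1 ≠ 0 := pow_ne_zero _ (by norm_num)
        exact (mul_eq_zero.1 h1.symm).resolve_right this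
      · intro ij' hij' hne'
        have hlt : j₀ < ij'.2 := lt_of_le_of_ne (hmin ij' hij') (fun h => hne' (huniq ij' hij' h.symm))
        rw [hx₀2, show (3 * ((1 : ℝ) / 3) - 1) = 0 by norm_num, zero_pow (by omega), mul_zero]
      · intro h; exact absurd hij₀ h
    -- remove the term and induct
    by_cases hij' : ij = ij₀
    · rw [hij']; exact hcoef
    · have hS' : (S.erase ij₀).card ≤ n := by
        rw [Finset.card_erase_of_mem hij₀]; omega
      refine IH (S.erase ij₀) hS' (fun ij' h' => hwS ij' (Finset.mem_of_mem_erase h')) (fun x => ?_) ij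
        (Finset.mem_erase.2 ⟨hij', hij⟩)
      have := hS0 x
      rw [← Finset.add_sum_erase S _ hij₀, hcoef, zero_mul, zero_mul, zero_add] at this
      exact this

end Summit.QuantumFields.YangMills.Theorems.RationalShortRootRigidity
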